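import Summits.QuantumFields.YangMills.Theorems.UnitScaleTiltProp8FlatPortBodyL0
import Summits.QuantumFields.YangMills.Theorems.UnitScaleTiltProp8FlatPortKernelRowsAllL
import HarnessLib

/-!
# Route `UnitScaleTilt`, crux K1 child «MinimiserStabilityRegPr» (stmt-QuantumFields-19200), v8 pillar **P2 `stub_flatOpsCubeSeq`** — THE PORT BRIDGE, file 10,
# **EVERY ODD `L ≥ 3`**: THE FULL ROW LIST `RowsAt` AND THE BODY OF THE REGISTERED P2 TEXT AT EVERY `Adm22` DATUM ON TORI WITH `≥ 5L` BIG BLOCKS PER DIRECTION —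
# the twin of ✓`UnitScaleTiltProp8FlatPortBodyL0` (`rowsAt_of_adm22`, `body_of_adm22`) with the block-size floor `(hℓ : 4 ≤ ℓ)` DELETED, read through
# ✓`FlatPortKernelRowsAllL.kernelRowsAt_of_adm22_allL` (lit-balaban's `…V1L3` lineage) instead of `FlatPortKernelRowsL0.kernelRowsAt_of_adm22`

Cell `ym3-torus` (HUMAN RULING D-0037, YM ladder rung R3), seat `ym-inputs-p09` (cell `pub/ym-inputs`, on-call hand; ★★OWNER RULING g26-№20 L-FLOOR LEDGER, item LF-1 ∕
(P2-L3)).  `--supports stmt-QuantumFields-19200 --as helper`; count-neutral; def-free.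

WHAT IS PROVED (sorry-free; axioms standard; no definition): **`rowsAt_of_adm22_allL`**, **`body_of_adm22_allL`** — statements of ✓`FlatPortBodyL0.rowsAt_of_adm22` ∕
`body_of_adm22` VERBATIM minus the binder `(hℓ : 4 ≤ ℓ)`; proofs verbatim (g16's `rowsAt_of_kernelRowsAt` + `body_of_rowsAt` BY NAME).  So the threaders of the halving chain
(`quarter164_L5`, `row165_L5(_su2)`, `gBand∕curlCurlSupRow(♯)∕columnInputs∕curlCurlPairing _of_adm22`, `hLetters_flatH_of_adm22`, and their `_allSizes` twins) can drop `hℓ` by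
reading `body_of_adm22_allL` — a one-token change per file.
HONEST SCOPE: the torus-size binder `a′ + 3 ≤ m + n` stays ((P2-small), cured by the (α) cover `flatH_cover`); constants crude (L3 dominance `1/12`); nothing here proves
`stub_halvingStep` or the crux; YM₃ on T³ = rung R3, NOT the Clay problem, no mass-gap claim.

References: T. Bałaban, CMP **96** (1984) 223–250 [Balaban1984PropagatorsII] (2.1)–(2.2) p.224, Prop. 2.6 (2.136) p.247, Cor. 2.8 (2.150)–(2.151) p.249; CMP **102** (1985) 277–309
[Balaban1985Variational] (46) p.285, (130) p.298, (157)–(158) p.302, (161)–(163) p.303, (165) p.304.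
-/

set_option autoImplicit false

noncomputable section

namespace Summit.QuantumFields.YangMills.Theorems.FlatPortBodyAllL

open Literature.MathematicalPhysics.QuantumFieldTheory.Balaban1983to89
open B6GlobalChartV1 (PV)
open B6SectADomainsV1 (Domains)
open B6SectAOperatorsV1 (BondIdx)
open T3ContinuumYM3Torus (T3Family)
open FlatCubeOpsText (Adm22 IsLevWeight distBI IsFlatH IsFlatGt HSupLetterG GtSupLetterG GtLaplaceLetterG HDecayLetterD RowSum162)
open FlatOpsLettersAssembly (RowsAt body_of_rowsAt levWeight_nonneg)
open FlatOpsFromKernelRows (rowsAt_of_kernelRowsAt)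
open FlatPortKernelRowsAllL (kernelRowsAt_of_adm22_allL)

/-- `1 ≤ 3` (named once). [folklore] -/
private theorem hd3 : 1 ≤ 2 + 1 := by norm_num

/-- **THE FULL ROW LIST `RowsAt` AT EVERY ADMISSIBLE DATUM — NO `Ω₁ = T` HYPOTHESIS, unit cubes `Λ₀` allowed** (tori with `≥ 5L` big blocks per direction, EVERY odd `L ≥ 3` — ✓`FlatPortBodyL0` twin with the block-size floor binder deleted), `C_Q = L`.
[cite: Balaban1984PropagatorsII, (2.1)-(2.2) p.224, Prop. 2.6 (2.136) p.247, Cor. 2.8 (2.150)-(2.151) p.249; Balaban1985Variational, (46) p.285, (130) p.298, (161)-(163) p.303] -/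
theorem rowsAt_of_adm22_allL (ℓ : ℕ) (hL : Odd (ℓ + 1) ∧ 1 < ℓ + 1) :
    ∃ (Mh₀ R₀ : ℕ) (C δ₀ B₃ CG : ℝ), 0 ≤ C ∧ 0 < δ₀ ∧ 0 < B₃ ∧ 0 ≤ CG ∧
    ∀ (m : ℕ) (hm : 1 ≤ m) (n K : ℕ) (_ : 1 ≤ K - n) (_ : K - n + 1 ≤ m + K) {Mh R a' : ℕ} (_ : Mh = (ℓ + 1) ^ a') (_ : Mh₀ ≤ Mh) (_ : R₀ ≤ R) (_ : a' + 3 ≤ m + n)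
      (D : Domains (PV 2 ℓ m K hd3 hL)) (_ : D.k = K - n) (_ : Adm22 D R ((ℓ + 1) * Mh))
      (w : ℕ → PBond (PV 2 ℓ m K hd3 hL) 0 → ℝ) (_ : IsLevWeight (⟨ℓ + 1, hL, m, hm⟩ : T3Family) n K D w),
      RowsAt (⟨ℓ + 1, hL, m, hm⟩ : T3Family) n K D w (max C (C * B₃)) δ₀ B₃ CG (((ℓ + 1 : ℕ) : ℝ)) := by
  obtain ⟨Mh₀, R₀, C, δ₀, B₃, CG, hC, hδ₀, hB₃, hCG, hmain⟩ := kernelRowsAt_of_adm22_allL ℓ hL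
  refine ⟨max Mh₀ 2, max R₀ 1, C, δ₀, B₃, CG, hC, hδ₀, hB₃, hCG, ?_⟩
  intro m hm n K hk1 hk' Mh R a' hMha hMh hR hsize D hDk hAdm w hw
  have hKR := hmain m hm n K hk1 hk' hMha (le_trans (le_max_left _ _) hMh) (le_trans (le_max_left _ _) hR) hsize D hDk hAdm w hw
  have hRM : 2 * ((⟨ℓ + 1, hL, m, hm⟩ : T3Family)).L ≤ R * ((ℓ + 1) * Mh) := by
    show 2 * (ℓ + 1) ≤ R * ((ℓ + 1) * Mh)
    have hR1 : 1 ≤ R := le_trans (le_max_right _ _) hR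
    have hM2 : 2 ≤ Mh := le_trans (le_max_right _ _) hMh
    calc 2 * (ℓ + 1) = 1 * ((ℓ + 1) * 2) := by ring
      _ ≤ R * ((ℓ + 1) * Mh) := Nat.mul_le_mul hR1 (Nat.mul_le_mul_left _ hM2)
  exact rowsAt_of_kernelRowsAt hw hDk hAdm hRM hC hδ₀.le hKR

/-- **THE BODY OF THE REGISTERED P2 TEXT AT EVERY ADMISSIBLE DATUM — NO `Ω₁ = T` HYPOTHESIS, unit cubes `Λ₀` allowed** (tori with `≥ 5L` big blocks per direction, EVERY odd `L ≥ 3` — ✓`FlatPortBodyL0` twin with the block-size floor binder deleted): the canonical `H`, `G̃`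
(pinned), the guarded (46)/`hG`/Laplacian letters at one constant `B₀(L)`, and a distance `dBI ≥ distBI` carrying (162) and the four (161)₁ rows at rate `δ₀(L)`.
[cite: Balaban1985Variational, (46) p.285, (130) p.298, (157)-(158) p.302, (161)-(163) p.303, (165) p.304; Balaban1984PropagatorsII, Prop. 2.6 (2.136) p.247, Cor. 2.8 p.249] -/
theorem body_of_adm22_allL (ℓ : ℕ) (hL : Odd (ℓ + 1) ∧ 1 < ℓ + 1) :
    ∃ (Mh₀ R₀ : ℕ) (B₀ δ₀ B₃ : ℝ), 0 < δ₀ ∧ 0 < B₃ ∧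
    ∀ (m : ℕ) (hm : 1 ≤ m) (n K : ℕ) (_ : 1 ≤ K - n) (_ : K - n + 1 ≤ m + K) {Mh R a' : ℕ} (_ : Mh = (ℓ + 1) ^ a') (_ : Mh₀ ≤ Mh) (_ : R₀ ≤ R) (_ : a' + 3 ≤ m + n)
      (D : Domains (PV 2 ℓ m K hd3 hL)) (_ : D.k = K - n) (_ : Adm22 D R ((ℓ + 1) * Mh))
      (w : ℕ → PBond (PV 2 ℓ m K hd3 hL) 0 → ℝ) (_ : IsLevWeight (⟨ℓ + 1, hL, m, hm⟩ : T3Family) n K D w),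
      ∃ (H : (BondIdx D → ℝ) →ₗ[ℝ] (PBond (PV 2 ℓ m K hd3 hL) 0 → ℝ)) (Gt : (PBond (PV 2 ℓ m K hd3 hL) 0 → ℝ) →ₗ[ℝ] (PBond (PV 2 ℓ m K hd3 hL) 0 → ℝ)),
        IsFlatH (⟨ℓ + 1, hL, m, hm⟩ : T3Family) n K D H ∧ IsFlatGt (⟨ℓ + 1, hL, m, hm⟩ : T3Family) n K D Gt ∧
        HSupLetterG (⟨ℓ + 1, hL, m, hm⟩ : T3Family) n K D w H B₀ ∧ GtSupLetterG (⟨ℓ + 1, hL, m, hm⟩ : T3Family) n K w Gt B₀ ∧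
          GtLaplaceLetterG (⟨ℓ + 1, hL, m, hm⟩ : T3Family) n K w Gt B₀ ∧
        ∃ dBI : PBond (PV 2 ℓ m K hd3 hL) 0 → BondIdx D → ℝ,
          (∀ b c, distBI D b c ≤ dBI b c) ∧ RowSum162 (⟨ℓ + 1, hL, m, hm⟩ : T3Family) n K D dBI w δ₀ B₃ ∧
            HDecayLetterD (⟨ℓ + 1, hL, m, hm⟩ : T3Family) n K D dBI w H B₀ δ₀ := by
  obtain ⟨Mh₀, R₀, C, δ₀, B₃, CG, hC, hδ₀, hB₃, hCG, hmain⟩ := rowsAt_of_adm22_allL ℓ hL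
  refine ⟨Mh₀, R₀, max (max C (C * B₃)) (CG + max C (C * B₃) * (((ℓ + 1 : ℕ) : ℝ)) * CG), δ₀, B₃, hδ₀, hB₃, ?_⟩
  intro m hm n K hk1 hk' Mh R a' hMha hMh hR hsize D hDk hAdm w hw
  exact body_of_rowsAt (levWeight_nonneg hw) hCG (Nat.cast_nonneg _) (hmain m hm n K hk1 hk' hMha hMh hR hsize D hDk hAdm w hw)

end Summit.QuantumFields.YangMills.Theorems.FlatPortBodyAllL

end
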